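import Mathlib
import Summits.Ventures.PercRepro2.TypedStarPieces
import Summits.Ventures.PercRepro2.TypedResidualCut

/-!
# The one-star class, subtracted from the core modulo the `K₅` star certificates (blind cell
PercRepro2, p2 g2, 2026-08-25; sub-claim S1 (C) of ASSIGNMENTS v12.61)

The **one-star class** `OneStar`: the typed graph has exactly one unmarked typed vertex `u`, of typed
degree `3`, with marks `v₁, v₂, v₃` as neighbours, at most one of them a root (every other typed edge
joins two marks; the both-root stars are hats, the hat rule's class).  On a
fully reduced instance with `MarksDistinct` marks, `typedCount_K3_star` (TypedStarK5.lean) writes the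
typed base as the placement sum of masked `K₅` counts at the marking `(0, 1, 2, 3, m b)` with
`m b ∈ {4, 3, 0}` (typer-1's `markMap`), so row 2′TRI on the class follows from the `K₅` star statement
`StarNonneg` at the finitely many `(marking, neighbourhood, type vector)` triples — the hypothesis
**`StarCerts R`** (typer-1's certificates: the neighbourhoods of three distinct marks with at most one
root, `7 + 2 + 2` at the three markings, `8` type vectors each; by `starCerts_of_pieces` it follows
from the certificate lists `StarPieces` of TypedStarPieces.lean).

* **`typedCount_nonneg_of_oneStar (hS : StarCerts R)`** — row 2′TRI on the one-star class;
* **`ResidualCoreS := ResidualCoreC ∧ ¬ OneStar`**,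
  **`HCov_all_of_residualCoreS_all (hS : StarCerts R) : ResidualCoreS_all R → HCov_all R`** —
  CONDITIONAL on the certificates (an explicit hypothesis, never a fact); unconditional once they land.

Own code; standard axioms.
-/

namespace Summit.Ventures.PercRepro2

open UnionCluster

namespace CovForm

namespace TypedRed

/-! ## The one-star class -/

section OneStar

variable {V : Type*} {E : Type*}

/-- **The one-star class**: an unmarked vertex `u` with typed edges `e₁, e₂, e₃` to the marks
`v₁, v₂, v₃`, every other typed edge joining two marks (so `u` is the only unmarked typed vertex and
has typed degree `3`). -/
def OneStar (ends : E → Sym2 V) (o a₁ a₂ a₃ b : V) (F : Finset E) : Prop :=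
  ∃ (u v₁ v₂ v₃ : V) (e₁ e₂ e₃ : E),
    (u ≠ o ∧ u ≠ a₁ ∧ u ≠ a₂ ∧ u ≠ a₃ ∧ u ≠ b) ∧
    (v₁ = o ∨ v₁ = a₁ ∨ v₁ = a₂ ∨ v₁ = a₃ ∨ v₁ = b) ∧
    (v₂ = o ∨ v₂ = a₁ ∨ v₂ = a₂ ∨ v₂ = a₃ ∨ v₂ = b) ∧
    (v₃ = o ∨ v₃ = a₁ ∨ v₃ = a₂ ∨ v₃ = a₃ ∨ v₃ = b) ∧
    e₁ ∈ F ∧ e₂ ∈ F ∧ e₃ ∈ F ∧ e₁ ≠ e₂ ∧ e₁ ≠ e₃ ∧ e₂ ≠ e₃ ∧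
    ends e₁ = s(u, v₁) ∧ ends e₂ = s(u, v₂) ∧ ends e₃ = s(u, v₃) ∧
    ¬ ((v₁ = a₁ ∨ v₂ = a₁ ∨ v₃ = a₁) ∧ (v₁ = a₂ ∨ v₂ = a₂ ∨ v₃ = a₂)) ∧
    (∀ e ∈ F, e ≠ e₁ → e ≠ e₂ → e ≠ e₃ → ∀ v ∈ ends e, v = o ∨ v = a₁ ∨ v = a₂ ∨ v = a₃ ∨ v = b)

end OneStar

/-! ## The certificates -/

section Certs

variable (R : Type*) [Field R] [LinearOrder R]

/-- A neighbourhood of the star the core needs: three distinct marks of the marking `(0, 1, 2, 3, b)`,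
at most one of them a root. -/
def StarNbhd (b p₁ p₂ p₃ : Fin 5) : Prop :=
  (p₁ = 0 ∨ p₁ = 1 ∨ p₁ = 2 ∨ p₁ = 3 ∨ p₁ = b) ∧ (p₂ = 0 ∨ p₂ = 1 ∨ p₂ = 2 ∨ p₂ = 3 ∨ p₂ = b) ∧
    (p₃ = 0 ∨ p₃ = 1 ∨ p₃ = 2 ∨ p₃ = 3 ∨ p₃ = b) ∧ p₁ ≠ p₂ ∧ p₁ ≠ p₃ ∧ p₂ ≠ p₃ ∧
    ¬ ((p₁ = 1 ∨ p₂ = 1 ∨ p₃ = 1) ∧ (p₁ = 2 ∨ p₂ = 2 ∨ p₃ = 2))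

/-- **The `K₅` star certificates** (typer-1's statement of record for the one-star class): the
`K₅` star statement `StarNonneg` at the three markings `(0, 1, 2, 3, b)`, `b ∈ {4, 3, 0}`, every
neighbourhood `StarNbhd` and every type vector in `{1, 2}³`. -/
def StarCerts : Prop :=
  ∀ b : Fin 5, (b = 4 ∨ b = 3 ∨ b = 0) → ∀ p₁ p₂ p₃ : Fin 5, StarNbhd b p₁ p₂ p₃ →
    ∀ t₁ t₂ t₃ : ℕ, (t₁ = 1 ∨ t₁ = 2) → (t₂ = 1 ∨ t₂ = 2) → (t₃ = 1 ∨ t₃ = 2) →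
      K5.StarNonneg R 0 1 2 3 b p₁ p₂ p₃ t₁ t₂ t₃

/-- **The certificates from the certificate lists**: `StarPieces` at every marking and neighbourhood
gives `StarCerts`. -/
theorem starCerts_of_pieces [IsStrictOrderedRing R]
    (h : ∀ b : Fin 5, (b = 4 ∨ b = 3 ∨ b = 0) → ∀ p₁ p₂ p₃ : Fin 5, StarNbhd b p₁ p₂ p₃ →
      K5.StarPieces R 0 1 2 3 b p₁ p₂ p₃) : StarCerts R :=
  fun b hb p₁ p₂ p₃ hp t₁ t₂ t₃ h1 h2 h3 => K5.starNonneg_of_pieces (h b hb p₁ p₂ p₃ hp) t₁ t₂ t₃ h1 h2 h3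

end Certs

/-! ## Row 2′TRI on the one-star class -/

section Theorem

variable {V : Type*} {E : Type*} [Fintype E] [DecidableEq E] [DecidableEq V]
variable {R : Type*} [Field R] [LinearOrder R] [IsStrictOrderedRing R]

omit [IsStrictOrderedRing R] in
/-- The image of a mark under `markMap` is one of `0, 1, 2, 3, markMap b`. -/
lemma markMap_mem {o a₁ a₂ a₃ b v : V} (h12 : a₁ ≠ a₂) (h31 : a₃ ≠ a₁) (h32 : a₃ ≠ a₂) (ho1 : o ≠ a₁)
    (ho2 : o ≠ a₂) (ho3 : o ≠ a₃) (hv : v = o ∨ v = a₁ ∨ v = a₂ ∨ v = a₃ ∨ v = b) :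
    K5.markMap o a₁ a₂ a₃ b v = 0 ∨ K5.markMap o a₁ a₂ a₃ b v = 1 ∨ K5.markMap o a₁ a₂ a₃ b v = 2 ∨
      K5.markMap o a₁ a₂ a₃ b v = 3 ∨ K5.markMap o a₁ a₂ a₃ b v = K5.markMap o a₁ a₂ a₃ b b := by
  rcases hv with rfl | rfl | rfl | rfl | rfl
  · exact Or.inl (K5.markMap_o _ _ _ _ _)
  · exact Or.inr (Or.inl (K5.markMap_a₁ ho1))
  · exact Or.inr (Or.inr (Or.inl (K5.markMap_a₂ h12 ho2)))
  · exact Or.inr (Or.inr (Or.inr (Or.inl (K5.markMap_a₃ h31 h32 ho3))))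
  · exact Or.inr (Or.inr (Or.inr (Or.inr rfl)))

omit [IsStrictOrderedRing R] in
/-- **Row 2′TRI on the one-star class**, on loop-free parallel-free typed graphs with `MarksDistinct`
marks and mixed types, from the `K₅` star certificates. -/
theorem typedCount_nonneg_of_oneStar (hS : StarCerts R) (ends : E → Sym2 V) (o a₁ a₂ a₃ b : V)
    (F : Finset E) (τ : E → ℕ) (hτ : ∀ e ∈ F, τ e = 1 ∨ τ e = 2) (hm : MarksDistinct o a₁ a₂ a₃ b)
    (hloop : ∀ f ∈ F, ¬ (ends f).IsDiag) (hpar : ∀ e ∈ F, ∀ f ∈ F, e ≠ f → ends e ≠ ends f)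
    (h : OneStar ends o a₁ a₂ a₃ b F) :
    0 ≤ typedCount F (fun _ => false) τ (K3 ends o a₁ a₂ a₃ b : Config E → Config E → Config E → R) := by
  obtain ⟨u, v₁, v₂, v₃, e₁, e₂, e₃, ⟨huo, hu1, hu2, hu3, hub⟩, hv₁, hv₂, hv₃, he₁, he₂, he₃, h12, h13,
    h23, hE1, hE2, hE3, hroots, hall⟩ := h
  obtain ⟨⟨ha12, ha31, ha32, ho1, ho2, hb1, hb2⟩, ho3⟩ := hm
  set M : Set V := K5.marks o a₁ a₂ a₃ b with hM
  have hmem : ∀ v, (v = o ∨ v = a₁ ∨ v = a₂ ∨ v = a₃ ∨ v = b) ↔ v ∈ M := by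
    intro v
    simp [hM, K5.marks]
  have hu : u ∉ M := by
    rw [← hmem]
    rintro (h | h | h | h | h)
    · exact huo h
    · exact hu1 h
    · exact hu2 h
    · exact hu3 h
    · exact hub h
  have hd : K5.StarData ends M u v₁ v₂ v₃ e₁ e₂ e₃ :=
    ⟨hu, (hmem v₁).1 hv₁, (hmem v₂).1 hv₂, (hmem v₃).1 hv₃, hE1, hE2, hE3, h12, h13, h23⟩
  set F₀ := ((F.erase e₁).erase e₂).erase e₃ with hF₀
  have hF₀sub : ∀ e ∈ F₀, e ∈ F ∧ e ≠ e₁ ∧ e ≠ e₂ ∧ e ≠ e₃ := by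
    intro e he
    rw [hF₀, Finset.mem_erase, Finset.mem_erase, Finset.mem_erase] at he
    exact ⟨he.2.2.2, he.2.2.1, he.2.1, he.1⟩
  have hMF : ∀ e ∈ F₀, ∀ v ∈ ends e, v ∈ M := by
    intro e he v hv
    obtain ⟨heF, h1, h2, h3⟩ := hF₀sub e he
    exact (hmem v).1 (hall e heF h1 h2 h3 v hv)
  have hinj : Set.InjOn (K5.markMap o a₁ a₂ a₃ b) M :=
    K5.markMap_injOn ha12 ha31 ha32 ho1 ho2 hb1 hb2 ho3
  have hMk : ∀ v ∈ M, v = o ∨ v = a₁ ∨ v = a₂ ∨ v = a₃ ∨ v = b := fun v hv => (hmem v).2 hv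
  refine K5.typedCount_K3_nonneg_of_starNonneg (K5.markMap o a₁ a₂ a₃ b) ends F hinj hd he₁ he₂ he₃ hMF
    (fun e he => hloop e (hF₀sub e he).1)
    (fun e he e' he' hee' => by
      by_contra hne
      exact hpar e (hF₀sub e he).1 e' (hF₀sub e' he').1 hne hee')
    ((hmem o).1 (Or.inl rfl)) ((hmem a₁).1 (Or.inr (Or.inl rfl)))
    ((hmem a₂).1 (Or.inr (Or.inr (Or.inl rfl)))) ((hmem a₃).1 (Or.inr (Or.inr (Or.inr (Or.inl rfl)))))
    ((hmem b).1 (Or.inr (Or.inr (Or.inr (Or.inr rfl))))) hMk τ ?_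
  rw [K5.markMap_o, K5.markMap_a₁ ho1, K5.markMap_a₂ ha12 ho2, K5.markMap_a₃ ha31 ha32 ho3]
  -- the neighbours are distinct (no parallel typed edges) and carry at most one root
  have hvne : ∀ {i j : E} {vi vj : V}, i ∈ F → j ∈ F → i ≠ j → ends i = s(u, vi) → ends j = s(u, vj) →
      vi ≠ vj := by
    intro i j vi vj hi hj hij hei hej hv
    exact hpar i hi j hj hij (by rw [hei, hej, hv])
  have hm12 : K5.markMap o a₁ a₂ a₃ b v₁ ≠ K5.markMap o a₁ a₂ a₃ b v₂ :=
    fun h => hvne he₁ he₂ h12 hE1 hE2 (hinj ((hmem v₁).1 hv₁) ((hmem v₂).1 hv₂) h)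
  have hm13 : K5.markMap o a₁ a₂ a₃ b v₁ ≠ K5.markMap o a₁ a₂ a₃ b v₃ :=
    fun h => hvne he₁ he₃ h13 hE1 hE3 (hinj ((hmem v₁).1 hv₁) ((hmem v₃).1 hv₃) h)
  have hm23 : K5.markMap o a₁ a₂ a₃ b v₂ ≠ K5.markMap o a₁ a₂ a₃ b v₃ :=
    fun h => hvne he₂ he₃ h23 hE2 hE3 (hinj ((hmem v₂).1 hv₂) ((hmem v₃).1 hv₃) h)
  have hroot1 : ∀ {v : V}, v ∈ M → K5.markMap o a₁ a₂ a₃ b v = 1 → v = a₁ := fun {v} hv h =>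
    hinj hv ((hmem a₁).1 (Or.inr (Or.inl rfl))) (h.trans (K5.markMap_a₁ ho1).symm)
  have hroot2 : ∀ {v : V}, v ∈ M → K5.markMap o a₁ a₂ a₃ b v = 2 → v = a₂ := fun {v} hv h =>
    hinj hv ((hmem a₂).1 (Or.inr (Or.inr (Or.inl rfl)))) (h.trans (K5.markMap_a₂ ha12 ho2).symm)
  have hnb : ¬ ((K5.markMap o a₁ a₂ a₃ b v₁ = 1 ∨ K5.markMap o a₁ a₂ a₃ b v₂ = 1 ∨
      K5.markMap o a₁ a₂ a₃ b v₃ = 1) ∧ (K5.markMap o a₁ a₂ a₃ b v₁ = 2 ∨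
      K5.markMap o a₁ a₂ a₃ b v₂ = 2 ∨ K5.markMap o a₁ a₂ a₃ b v₃ = 2)) := by
    rintro ⟨h1, h2⟩
    refine hroots ⟨?_, ?_⟩
    · rcases h1 with h | h | h
      · exact Or.inl (hroot1 ((hmem v₁).1 hv₁) h)
      · exact Or.inr (Or.inl (hroot1 ((hmem v₂).1 hv₂) h))
      · exact Or.inr (Or.inr (hroot1 ((hmem v₃).1 hv₃) h))
    · rcases h2 with h | h | h
      · exact Or.inl (hroot2 ((hmem v₁).1 hv₁) h)
      · exact Or.inr (Or.inl (hroot2 ((hmem v₂).1 hv₂) h))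
      · exact Or.inr (Or.inr (hroot2 ((hmem v₃).1 hv₃) h))
  exact hS _ (K5.markMap_b ha31 ha32 hb1 hb2 ho3) _ _ _
    ⟨markMap_mem ha12 ha31 ha32 ho1 ho2 ho3 hv₁, markMap_mem ha12 ha31 ha32 ho1 ho2 ho3 hv₂,
      markMap_mem ha12 ha31 ha32 ho1 ho2 ho3 hv₃, hm12, hm13, hm23, hnb⟩
    _ _ _ (hτ e₁ he₁) (hτ e₂ he₂) (hτ e₃ he₃)

end Theorem

/-! ## The conjunct in the core -/

section Core

variable {V : Type*} {E : Type*} [DecidableEq V] [Fintype E] [DecidableEq E]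

/-- **The core without a root cut and without a one-star**: `ResidualCoreC` (TypedResidualCut.lean)
and not `OneStar`. -/
structure ResidualCoreS (ends : E → Sym2 V) (o a₁ a₂ a₃ b : V) (F : Finset E) : Prop where
  coreC : ResidualCoreC ends o a₁ a₂ a₃ b F
  not_oneStar : ¬ OneStar ends o a₁ a₂ a₃ b F

end Core

section Closure

variable (R : Type*) [Field R] [LinearOrder R] [IsStrictOrderedRing R]

/-- **Row 2′TRI on `ResidualCoreS`, over every finite graph.** -/
def ResidualCoreS_all : Prop :=
  ∀ (V E : Type) [Fintype V] [DecidableEq V] [Fintype E] [DecidableEq E]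
    (ends : E → Sym2 V) (o a₁ a₂ a₃ b : V) (F : Finset E) (τ : E → ℕ),
    (∀ e ∈ F, τ e = 1 ∨ τ e = 2) → ResidualCoreS ends o a₁ a₂ a₃ b F →
      0 ≤ typedCount F (fun _ => false) τ
        (K3 ends o a₁ a₂ a₃ b : Config E → Config E → Config E → R)

/-- **CONDITIONAL on the `K₅` star certificates: the crux of record from (TRI) on the core without a
root cut and without a one-star.** -/
theorem HCov_all_of_residualCoreS_all (hS : StarCerts R) (hc : ResidualCoreS_all R) : HCov_all R := by
  refine HCov_all_of_residualCoreC_all R ?_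
  intro V E _ _ _ _ ends o a₁ a₂ a₃ b F τ hτ hcore
  by_cases hstar : OneStar ends o a₁ a₂ a₃ b F
  · have hred := hcore.core.residualConR.residualCon.residual.reduced
    exact typedCount_nonneg_of_oneStar hS ends o a₁ a₂ a₃ b F τ hτ hcore.core.marks hred.no_loop
      hred.no_parallel hstar
  · exact hc V E ends o a₁ a₂ a₃ b F τ hτ ⟨hcore, hstar⟩

end Closure

end TypedRed

end CovForm

end Summit.Ventures.PercRepro2
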